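import Literature.MathematicalPhysics.QuantumFieldTheory.Balaban1983to89.Node00.ZeroInputStepT
import Literature.MathematicalPhysics.QuantumFieldTheory.Balaban1983to89.Node00.BackgroundSelOfRecord
import Literature.MathematicalPhysics.QuantumFieldTheory.Balaban1983to89.B12EffectiveActionInvarianceT

/-!
# NODE O port, row PT-A′ helper lane (PTZ-1): [I] §2 at ZERO INPUT — GENERIC rows over `Node00/ZeroInputStepT`
# ((Z) the zero-input step is (2.1) with 𝐄_k := 0 ∕ (2.12)'s outside line; (L) the difference functional is the response of the
# step minus the transported input; (1.19)∕(2.16) gauge invariance of the step functional `R_k(A)` for a gauge-invariant bound `A`)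

[Balaban1987RG1] = [I] (CMP 109, 1987): (0.19) p. 255, (0.21)–(0.22) p. 256, (1.3) p. 260, (1.6) p. 261, (1.19) p. 263, (2.1)–(2.3)
p. 265, (2.12)–(2.13) p. 268, (2.16) p. 269; [Balaban1985Variational] = [15] (CMP 102, 1985): Thm 1 p. 279, (181) p. 307.

Seat `ymgap-nodeO-port-PTZ-1` g0 (prover, HELPER MODE; operator key R623-ym (1): every file `--supports stmt-QuantumFields-27930 --as helper`;
nothing keyed to the unsigned item 26648).  CRIT-1 RULING Q-5 (HOME STATUS l.3807) (β): rows cut over the χ-GENERIC layer with `χ`, `T`, the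
bound action `A` BOUND are selection-free; its last sentence: `ZeroInput.stepOutT`'s second summand `A (Ū^k (U_{k+1} W))` reads the BARE
choice `Node00.Uk`, so a row that moves its value must display `GaugeInvariant A` (⇒ residual-invariance of `A ∘ Ū^k`,
`B16Sect1Backgrounds.iter_gaugeAct`) and the [B11] clauses `UkExists` ∕ `UniqueUkOrbit` BY NAME — which is exactly how §3 is typed.  NO row
below instantiates `χ := chiβOfRecord₁₃ θ` or names `recordΦf` ∕ `recordΦz` (0 tokens of the χ-cone of record).

WHAT IS PROVED (every `χ`, `T`, `A`, `E`, `ε`, `K`, `g`, `k` a bound variable; `R_k(A) := ZeroInput.stepOutT … A`, `A⁰_k := ZeroInput.mainTermT`,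
`𝓝⁰_{k+1} := ZeroInput.zeroInputMergedTermT`, `𝓝_{k+1} := Node00.mergedTermT`, `𝐓_k(A) := B12Eq019ActionBody.nextAction (T K k) (χ K g k) GF_k g_k A`):
* §1 (Z).  `nextAction_main_add_eq_action21` — for an input history that is a function `E` of the background field, `𝐓_k(A⁰_k + E ∘ U_k)`
  IS print's (2.1) (`B12Eq019ActionBody.action21 … (Uk …) wilsonAction4 E`, definitional); `nextAction_mainTermT_eq_action21` — at ZERO input
  (`E := 0`); `zeroInputMergedTermT_eq_action21` — 𝓝⁰_{k+1}(W) = (2.1)∣_{𝐄_k = 0}(W) + (1∕g_k²)A(U_k(Ū^k U_{k+1}W)); `zeroInputMergedTermT_eq_of_isBackground`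
  — with [15] Thm 1's restriction clause «the level-(k+1) minimiser over `W` is a level-k minimiser over its own k-average» (print (2.3) p. 265,
  `V^{(k)} = Ū^{k+1}_k ≡ M_k(U_{k+1})`) the outside line of (2.12) collapses: 𝓝⁰_{k+1}(W) = 𝐓_k(A⁰_k)(W) + (1∕g_k²)A(U_{k+1}W);
  `stepOutT_main_add_eq_of_orbitRel` — the same for a general gauge-invariant input `E ∘ U_k` under the (1.1) orbit clause:
  `R_k(A⁰_k + E∘U_k)(W) = (2.1)(W) − [−(1∕g_k²)A(U_{k+1}W) + E(U_{k+1}W)]` — print's «E^{(k+1)}(g_k, U_{k+1})» of (2.12)–(2.13) is the merged term.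
  `zeroInputMergedTermFamilyMatT_apply` ∕ `mergedTermFamilyMatT_sub_zeroInput` — the β-layer∕matrix-carrier species (what the record's
  wrappers read) ARE `R_k(A⁰_k)` resp. 𝓝 − 𝓝⁰ at the clamped history and the read field (`rfl`).
* §2 (L).  `stepOutT_add_sub` — for ANY input split `A + E`: `R_k(A + E)(W) − R_k(A)(W) = [𝐓_k(A + E) − 𝐓_k(A)](W) − E(Ū^k U_{k+1} W)` (the tree's
  `dChannel_eq` is the instance `A := A⁰_k`, `E := 𝐄_k`); `stepOutT_congr` ∕ `stepOutT_add_of_vanish` — `R_k` reads its input only on `supp χ_k ∪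
  {Ū^k U_{k+1} W}`, an input vanishing there has NO response (generic form of the tree's first-level identity `dChannel_zero_at_first_level'`);
  `integrand_add_const` ∕ `nextAction_add_const` ∕ `stepOutT_add_const` — for a transport HOMOGENEOUS of degree one (displayed hypothesis; every
  kernel ∕ fibre-integral transformation (0.13) is) a CONSTANT input `c` is absorbed by `𝐍_k`: `𝐓_k(A + c) = 𝐓_k(A)`, `R_k(A + c) = R_k(A) − c`;
  `stepOutT_main_add_one_smul` ∕ `_zero_smul` ∕ `_smul_sub` — the real pencil `t ↦ R_k(A⁰_k + t·𝐄_k)` has the ends 𝓝_{k+1} (t = 1) and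
  𝓝⁰_{k+1} (t = 0); `stepOutT_one` — `R_k(A)(1) = −A(Ū^k U_{k+1}(1))` ((0.19)'s normalisation `𝐓_k(A)(1) = 0`).
* §3 (1.19)∕(2.16).  `wilsonAction4_Uk_gaugeAct` — `A(U_k(V^v)) = A(U_k(V))` for ALL `v`, `V` (`k ≤ m + K`), UNCONDITIONALLY (mutual minimality
  `Node00.wilsonAction4_eq_of_isBackground` + transport of minimisers `Node00.isBackground_gaugeAct_toMS'` + the junk branch `Node00.ukExists_gaugeAct_iff'`);
  `gaugeInvariant_mainTermT` — A⁰_k is gauge invariant (p. 263 «an easily verifiable statement for all explicitly defined terms in the action (1.3)»);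
  `orbitRel_Uk_gaugeAct_blockLift` — [15] (181) for the BARE choice at orbit level: `(U_k V)^{v̄}` and `U_k(V^v)` lie in one residual orbit
  (`UkExists … V`, `UniqueUkOrbit … (V^v)`; sibling of `Node00.UkSel_gaugeAct_blockLift`); `apply_iter_Uk_gaugeAct` — hence every GAUGE-INVARIANT level-k
  functional reads the same value at `Ū^k U_{k+1}(W^v)` and `Ū^k U_{k+1}(W)`; `stepOutT_gaugeAct` — `R_k(A)(W^v) = R_k(A)(W)` from: the mapping
  property of `T K k` («lift-invariant ⇒ gauge invariant», p. 254), `LiftInvariant (χ K g k)`, `GaugeInvariant A`, `k + 1 ≤ m + K`, `UkExists (k+1) W`,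
  `UniqueUkOrbit (k+1) (W^v)`; corollaries `zeroInputMergedTermT_gaugeAct` (the (1.19) row of (Z) at the functional level), `mergedTermT_gaugeAct` and
  `dChannel_gaugeAct` (the (1.19) row of (L): 𝓝_{k+1} and 𝓓_{k+1} := 𝓝 − 𝓝⁰, under `B12EffectiveActionInvarianceT.gaugeInvariant_effActionHT`'s
  hypotheses — FREE as stated with `hχ` displayed; the bare-record instance is selection-DEPENDENT per CRIT-1 Q-3 and is not taken here).

HONEST FRAMING.  Kernel bookkeeping over the tree's definitions (`rfl`, `ring`, rewriting by named tree theorems); the [B11] clauses, the mapping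
property of `T` and the lift-invariance of `χ` are HYPOTHESES displayed by name; NOTHING of Bałaban's estimates is asserted, ported or discharged;
no named fact introduced; items 26648 (unsigned) ∕ 27930⁷ ∕ 27931⁷ OPEN; K0⁷ ∕ stub 2′ OPEN; counts unmoved; finite 𝕋⁴ at fixed ε — NOT continuum ∕
OS ∕ Clay; the Yang–Mills mass gap is NOT proved by any of this.  No `sorry`, no `instance`, no `notation`, no new `def`, standard axioms.
-/

noncomputable section

namespace Summit.QuantumFields.YangMills.Theorems.PortZD

open Literature.MathematicalPhysics.QuantumFieldTheory.Balaban1983to89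
open Literature.MathematicalPhysics.QuantumFieldTheory.Balaban1983to89.Node00
open Literature.MathematicalPhysics.QuantumFieldTheory.Balaban1983to89.Node00.ZeroInput
open T4Continuum (T4Family)
open B12Eq019ActionBody (nextAction nextAction_apply normConst normConst_def integrand integrand_apply action21 nextAction_congr_support)
open B12RTGaugeInvariance254 (LiftInvariant liftInvariant_of_gaugeInvariant liftTransf)
open B12EffectiveActionInvarianceT (gaugeInvariant_nextAction gfOfRecord_liftInvariant gaugeInvariant_effActionHT)
open B12GaugeOrbits021 (OrbitRel)
open B15Eq177GaugeInvariance (blockLift toMS_blockLift_self)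
open B16Sect1Backgrounds (toMS iter_gaugeAct)
open GaugeField (gaugeAct GaugeInvariant)

variable (F : T4Family) (N : ℕ) [NeZero N]

/-! ## §1. (Z) — the zero-input step is (2.1) with 𝐄_k := 0; (1.6) ∕ (2.12) bookkeeping of 𝓝⁰_{k+1} -/

/-- **(2.1) for an input history that is a function of the background**: `𝐓_k(A⁰_k + E∘U_k) = (2.1)` — the step (0.19) applied to the
(0.22)-form action `V ↦ −(1∕g_k²)A(U_k(V)) + E(U_k(V))` IS `B12Eq019ActionBody.action21 … (Uk …) wilsonAction4 E` (definitional).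
[cite: Balaban1987RG1, (2.1) p.265] -/
theorem nextAction_main_add_eq_action21 (T : Transport F N) (χ : (K : ℕ) → (ℕ → ℝ) → (k : ℕ) → Density (F.P K) k (SU N))
    (ε : ℝ) (K : ℕ) (g : ℕ → ℝ) (k : ℕ) (E : GaugeField (F.P K) 0 (SU N) → ℝ) :
    nextAction (T K k) (χ K g k) (gfOfRecord F N K k) (g k) (fun V => mainTermT F N ε K g k V + E (Uk F N K k ε V)) =
      action21 (T K k) (χ K g k) (gfOfRecord F N K k) (g k) (Uk F N K k ε) wilsonAction4 E := rfl

/-- **(2.1) AT ZERO INPUT**: `𝐓_k(A⁰_k) = (2.1)∣_{𝐄_k := 0}`. [cite: Balaban1987RG1, (2.1) p.265, (1.3) p.260] -/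
theorem nextAction_mainTermT_eq_action21 (T : Transport F N) (χ : (K : ℕ) → (ℕ → ℝ) → (k : ℕ) → Density (F.P K) k (SU N))
    (ε : ℝ) (K : ℕ) (g : ℕ → ℝ) (k : ℕ) :
    nextAction (T K k) (χ K g k) (gfOfRecord F N K k) (g k) (mainTermT F N ε K g k) =
      action21 (T K k) (χ K g k) (gfOfRecord F N K k) (g k) (Uk F N K k ε) wilsonAction4 (fun _ => 0) := by
  rw [← nextAction_main_add_eq_action21]
  simp only [add_zero]

/-- **𝓝⁰_{k+1} through (2.1)**: `𝓝⁰_{k+1}(W) = (2.1)∣_{𝐄_k := 0}(W) + (1∕g_k²)A(U_k(Ū^k U_{k+1} W))` ((1.6) with the input switched off).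
[cite: Balaban1987RG1, (1.6) p.261, (2.1) p.265] -/
theorem zeroInputMergedTermT_eq_action21 (T : Transport F N) (χ : (K : ℕ) → (ℕ → ℝ) → (k : ℕ) → Density (F.P K) k (SU N))
    (ε : ℝ) (K : ℕ) (g : ℕ → ℝ) (k : ℕ) (W : GaugeField (F.P K) (k + 1) (SU N)) :
    zeroInputMergedTermT F N T χ ε K g k W =
      action21 (T K k) (χ K g k) (gfOfRecord F N K k) (g k) (Uk F N K k ε) wilsonAction4 (fun _ => 0) W +
        (1 / (g k) ^ 2) * wilsonAction4 (Uk F N K k ε (Averaging.iter (avOfRecord F N K) k (Uk F N K (k + 1) ε W))) := by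
  rw [zeroInputMergedTermT_eq_stepOut, stepOutT, nextAction_mainTermT_eq_action21]
  unfold mainTermT
  ring

/-- **THE OUTSIDE LINE OF (2.12) AT ZERO INPUT COLLAPSES** under [15] Thm 1's RESTRICTION clause — «the level-(k+1) minimiser `U_{k+1}(W)`
is a level-k minimiser over its own k-average `Ū^k U_{k+1}(W)`» (print (2.3): `V^{(k)} = Ū^{k+1}_k ≡ M_k(U_{k+1})`): then `A(U_k(Ū^k U_{k+1}W)) =
A(U_{k+1}W)` by mutual minimality (`Node00.wilsonAction4_eq_of_isBackground`), and `𝓝⁰_{k+1}(W) = 𝐓_k(A⁰_k)(W) + (1∕g_k²)A(U_{k+1}(W))` — the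
zero-input new term «E^{(k+1)}(g_k, U_{k+1})» of (2.12)–(2.13) read off `A_{k+1} = −(1∕g_k²)A(U_{k+1}) + E^{(k+1)}`.
[cite: Balaban1987RG1, (2.3) p.265, (2.12)–(2.13) p.268; Balaban1985Variational, Thm 1 p.279] -/
theorem zeroInputMergedTermT_eq_of_isBackground (T : Transport F N) (χ : (K : ℕ) → (ℕ → ℝ) → (k : ℕ) → Density (F.P K) k (SU N))
    (ε : ℝ) (K : ℕ) (g : ℕ → ℝ) (k : ℕ) (W : GaugeField (F.P K) (k + 1) (SU N))
    (hR : IsBackground (avOfRecord F N K) (bgReg F N K k ε) k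
      (Averaging.iter (avOfRecord F N K) k (Uk F N K (k + 1) ε W)) (Uk F N K (k + 1) ε W)) :
    zeroInputMergedTermT F N T χ ε K g k W =
      nextAction (T K k) (χ K g k) (gfOfRecord F N K k) (g k) (mainTermT F N ε K g k) W +
        (1 / (g k) ^ 2) * wilsonAction4 (Uk F N K (k + 1) ε W) := by
  rw [zeroInputMergedTermT_eq_stepOut, stepOutT, wilsonAction4_eq_of_isBackground hR]
  unfold mainTermT
  ring

/-- **(2.12) ⟹ (2.13) FOR A GENERAL INPUT HISTORY `E ∘ U_k`** (E a GAUGE-INVARIANT functional of the fine field, (1.19)), under the (1.1) ORBIT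
clause «`U_k(Ū^k U_{k+1}W)` lies in the level-k residual orbit of `U_{k+1}(W)`» (`B12GaugeOrbits021.OrbitRel`): the step functional of the
(0.22)-form action is (2.1) minus the outside line of (2.12) read at `U_{k+1}(W)`:
`R_k(A⁰_k + E∘U_k)(W) = (2.1)(W) − [−(1∕g_k²)A(U_{k+1}W) + E(U_{k+1}W)]` — i.e. print's «E^{(k+1)}(g_k, U_{k+1})» is the tree's merged term.
[cite: Balaban1987RG1, (1.1) p.260, (1.6) p.261, (2.12)–(2.13) p.268] -/
theorem stepOutT_main_add_eq_of_orbitRel (T : Transport F N) (χ : (K : ℕ) → (ℕ → ℝ) → (k : ℕ) → Density (F.P K) k (SU N))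
    (ε : ℝ) (K : ℕ) (g : ℕ → ℝ) (k : ℕ) {E : GaugeField (F.P K) 0 (SU N) → ℝ} (hE : GaugeInvariant E)
    (W : GaugeField (F.P K) (k + 1) (SU N))
    (hO : OrbitRel k (Uk F N K (k + 1) ε W) (Uk F N K k ε (Averaging.iter (avOfRecord F N K) k (Uk F N K (k + 1) ε W)))) :
    stepOutT F N T χ ε K g k (fun V => mainTermT F N ε K g k V + E (Uk F N K k ε V)) W =
      action21 (T K k) (χ K g k) (gfOfRecord F N K k) (g k) (Uk F N K k ε) wilsonAction4 E W -
        (-(1 / (g k) ^ 2) * wilsonAction4 (Uk F N K (k + 1) ε W) + E (Uk F N K (k + 1) ε W)) := by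
  obtain ⟨u, -, hu⟩ := hO
  rw [stepOutT, nextAction_main_add_eq_action21]
  unfold mainTermT
  rw [hu, B14Eq16FaddeevPopov.wilsonAction4_gaugeAct', hE]

/-- **THE β-LAYER ∕ MATRIX-CARRIER SPECIES READ THE SAME STEP FUNCTIONAL**: one unfolding below the record's zero-input wrapper, the family
`ZeroInput.zeroInputMergedTermFamilyMatT T χ ε k hist K W` IS `R_k(A⁰_k)` at the clamped history `extd hist` and the field `readField … W`
(definitional; the shape the (Z) pieces slot reads). [cite: Balaban1987RG1, (1.20) p.264, (1.6) p.261 (bookkeeping)] -/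
theorem zeroInputMergedTermFamilyMatT_apply (T : Transport F N) (χ : (K : ℕ) → (ℕ → ℝ) → (k : ℕ) → Density (F.P K) k (SU N))
    (ε : ℝ) (k : ℕ) (hist : Fin (k + 1) → ℝ) (K : ℕ) (W : Fin (F.P K).d → Site (F.P K) (k + 1) → Matrix (Fin N) (Fin N) ℂ) :
    zeroInputMergedTermFamilyMatT F N T χ ε k hist K W =
      stepOutT F N T χ ε K (T4FlagMemory.extd hist) k (mainTermT F N ε K (T4FlagMemory.extd hist) k) (readField F N (suOfMat N) W) := rfl

/-- **… AND THEIR DIFFERENCE IS THE DIFFERENCE FUNCTIONAL 𝓓_{k+1} = 𝓝_{k+1} − 𝓝⁰_{k+1}** at the same history and field (definitional; the shape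
one unfolding below the (L) pieces slot `Φf − Φz` of the zero-input split). [cite: Balaban1987RG1, (1.20) p.264, (1.6) p.261 (bookkeeping)] -/
theorem mergedTermFamilyMatT_sub_zeroInput (T : Transport F N) (χ : (K : ℕ) → (ℕ → ℝ) → (k : ℕ) → Density (F.P K) k (SU N))
    (ε : ℝ) (k : ℕ) (hist : Fin (k + 1) → ℝ) (K : ℕ) (W : Fin (F.P K).d → Site (F.P K) (k + 1) → Matrix (Fin N) (Fin N) ℂ) :
    mergedTermFamilyMatT F N T χ ε k hist K W - zeroInputMergedTermFamilyMatT F N T χ ε k hist K W =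
      mergedTermT F N T χ ε K (T4FlagMemory.extd hist) k (readField F N (suOfMat N) W) -
        zeroInputMergedTermT F N T χ ε K (T4FlagMemory.extd hist) k (readField F N (suOfMat N) W) := rfl

/-! ## §2. (L) — the difference functional: response of the step minus the transported input -/

/-- **THE RESPONSE-MINUS-TRANSPORT SHAPE FOR ANY INPUT SPLIT**: `R_k(A + E)(W) − R_k(A)(W) = [𝐓_k(A + E)(W) − 𝐓_k(A)(W)] − E(Ū^k U_{k+1} W)`
(the tree's `ZeroInput.dChannel_eq` is the instance `A := A⁰_k`, `E := 𝐄_k`; print: the curly bracket of (2.12) is the part of the exponent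
carried by the input 𝐄_k, and (1.6) subtracts the input transported to the new background). [cite: Balaban1987RG1, (1.6) p.261, (2.12) p.268] -/
theorem stepOutT_add_sub (T : Transport F N) (χ : (K : ℕ) → (ℕ → ℝ) → (k : ℕ) → Density (F.P K) k (SU N)) (ε : ℝ) (K : ℕ)
    (g : ℕ → ℝ) (k : ℕ) (A E : Density (F.P K) k (SU N)) (W : GaugeField (F.P K) (k + 1) (SU N)) :
    stepOutT F N T χ ε K g k (A + E) W - stepOutT F N T χ ε K g k A W =
      (nextAction (T K k) (χ K g k) (gfOfRecord F N K k) (g k) (A + E) W -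
          nextAction (T K k) (χ K g k) (gfOfRecord F N K k) (g k) A W) -
        E (Averaging.iter (avOfRecord F N K) k (Uk F N K (k + 1) ε W)) := by
  simp only [stepOutT, Pi.add_apply]
  ring

/-- **`R_k` READS ITS INPUT ONLY ON `supp χ_k` AND AT THE TRANSPORTED POINT** (*«the domain of integration in (2.1) is restricted to
configurations V for which U_k(V) ∈ U_k(ε₀)»*): two inputs agreeing wherever `χ_k ≠ 0` and at `Ū^k U_{k+1} W` have the same output at `W`.
[cite: Balaban1987RG1, (2.1) p.265] -/
theorem stepOutT_congr (T : Transport F N) (χ : (K : ℕ) → (ℕ → ℝ) → (k : ℕ) → Density (F.P K) k (SU N)) (ε : ℝ) (K : ℕ)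
    (g : ℕ → ℝ) (k : ℕ) {A A' : Density (F.P K) k (SU N)} (W : GaugeField (F.P K) (k + 1) (SU N))
    (hχ : ∀ U, χ K g k U ≠ 0 → A U = A' U)
    (hpt : A (Averaging.iter (avOfRecord F N K) k (Uk F N K (k + 1) ε W)) = A' (Averaging.iter (avOfRecord F N K) k (Uk F N K (k + 1) ε W))) :
    stepOutT F N T χ ε K g k A W = stepOutT F N T χ ε K g k A' W := by
  rw [stepOutT, stepOutT, nextAction_congr_support (T K k) hχ, hpt]

/-- **AN INPUT INVISIBLE TO THE STEP HAS NO RESPONSE**: if `E` vanishes on `supp χ_k` and at `Ū^k U_{k+1} W`, then `R_k(A + E)(W) = R_k(A)(W)` —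
the generic form of the tree's first-level identity `ZeroInput.dChannel_zero_at_first_level'` ((0.17): no history at the first step).
[cite: Balaban1987RG1, (0.17) p.255, (2.1) p.265] -/
theorem stepOutT_add_of_vanish (T : Transport F N) (χ : (K : ℕ) → (ℕ → ℝ) → (k : ℕ) → Density (F.P K) k (SU N)) (ε : ℝ) (K : ℕ)
    (g : ℕ → ℝ) (k : ℕ) (A : Density (F.P K) k (SU N)) {E : Density (F.P K) k (SU N)} (W : GaugeField (F.P K) (k + 1) (SU N))
    (hχ : ∀ U, χ K g k U ≠ 0 → E U = 0) (hpt : E (Averaging.iter (avOfRecord F N K) k (Uk F N K (k + 1) ε W)) = 0) :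
    stepOutT F N T χ ε K g k (A + E) W = stepOutT F N T χ ε K g k A W :=
  stepOutT_congr F N T χ ε K g k W (fun U hU => by rw [Pi.add_apply, hχ U hU, add_zero]) (by rw [Pi.add_apply, hpt, add_zero])

/-- A constant added to the input multiplies the fine density of (0.19) by `e^c`. [cite: Balaban1987RG1, (0.19) p.255 (bookkeeping)] -/
theorem integrand_add_const {P : Params} {G : Type*} {k : ℕ} (χ GF : Density P k G) (gk : ℝ) (A : Density P k G) (c : ℝ) :
    integrand χ GF gk (fun U => A U + c) = fun U => Real.exp c * integrand χ GF gk A U := by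
  funext U
  rw [integrand_apply, integrand_apply, ← add_assoc, Real.exp_add]
  ring

/-- **CONSTANTS ARE ABSORBED BY THE NORMALISATION `𝐍_k`**: for a transport HOMOGENEOUS of degree one in the density (every kernel ∕
fibre-integral transformation (0.13) `(Tρ)(V) = ∫dU t(V,U)ρ(U)` is), `𝐓_k(A + c) = 𝐓_k(A)` — *«log 𝐍_k⁻¹ …»* with *«𝐍_k given by the integral
above with V = 1»* cancels the factor `e^c` (no positivity needed: `(e^c N)⁻¹(e^c X) = N⁻¹X` in a field). [cite: Balaban1987RG1, (0.19) p.255–256 (bookkeeping)] -/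
theorem nextAction_add_const {P : Params} {G : Type*} [GaugeGroup G] {k : ℕ} {T : Density P k G → Density P (k + 1) G}
    (hT : ∀ (a : ℝ) (ρ : Density P k G), T (fun U => a * ρ U) = fun V => a * T ρ V)
    (χ GF : Density P k G) (gk : ℝ) (A : Density P k G) (c : ℝ) :
    nextAction T χ GF gk (fun U => A U + c) = nextAction T χ GF gk A := by
  funext V
  rw [nextAction_apply, nextAction_apply, normConst_def, normConst_def, integrand_add_const, hT, mul_inv, mul_mul_mul_comm,
    inv_mul_cancel₀ (Real.exp_pos c).ne', one_mul]

/-- **… SO A CONSTANT INPUT PASSES THROUGH THE STEP WITH THE OPPOSITE SIGN AND NO RESPONSE**: `R_k(A + c)(W) = R_k(A)(W) − c` (degree-one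
homogeneous `T K k`).  The difference functional is therefore NOT contractive on constants — (L)'s contraction `ρ < 1` lives on the
NORMALISED histories of record (`A_j(1) = 0`, `B12Eq019ActionBody.nextAction_one`). [cite: Balaban1987RG1, (0.19) p.255, (1.6) p.261 (bookkeeping)] -/
theorem stepOutT_add_const (T : Transport F N) (χ : (K : ℕ) → (ℕ → ℝ) → (k : ℕ) → Density (F.P K) k (SU N)) (ε : ℝ) (K : ℕ)
    (g : ℕ → ℝ) (k : ℕ) (hT : ∀ (a : ℝ) (ρ : Density (F.P K) k (SU N)), T K k (fun U => a * ρ U) = fun V => a * T K k ρ V)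
    (A : Density (F.P K) k (SU N)) (c : ℝ) (W : GaugeField (F.P K) (k + 1) (SU N)) :
    stepOutT F N T χ ε K g k (fun U => A U + c) W = stepOutT F N T χ ε K g k A W - c := by
  rw [stepOutT, stepOutT, nextAction_add_const hT]
  ring

/-- **THE REAL HISTORY PENCIL, END `t = 1`**: `R_k(A⁰_k + 1·𝐄_k)(W) = 𝓝_{k+1}(W)` ((0.22) split `A_k = A⁰_k + 𝐄_k`, `ZeroInput.effActionHT_eq_main_add_Ek_fun`).
[cite: Balaban1987RG1, (0.22) p.256, (1.6) p.261 (bookkeeping)] -/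
theorem stepOutT_main_add_one_smul (T : Transport F N) (χ : (K : ℕ) → (ℕ → ℝ) → (k : ℕ) → Density (F.P K) k (SU N)) (ε : ℝ)
    (K : ℕ) (g : ℕ → ℝ) (k : ℕ) (W : GaugeField (F.P K) (k + 1) (SU N)) :
    stepOutT F N T χ ε K g k (mainTermT F N ε K g k + (1 : ℝ) • EkT F N T χ ε K g k) W = mergedTermT F N T χ ε K g k W := by
  rw [one_smul, ← effActionHT_eq_main_add_Ek_fun, mergedTermT_eq_stepOut]

/-- **THE REAL HISTORY PENCIL, END `t = 0`**: `R_k(A⁰_k + 0·𝐄_k)(W) = 𝓝⁰_{k+1}(W)`. [cite: Balaban1987RG1, (1.6) p.261 (bookkeeping)] -/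
theorem stepOutT_main_add_zero_smul (T : Transport F N) (χ : (K : ℕ) → (ℕ → ℝ) → (k : ℕ) → Density (F.P K) k (SU N)) (ε : ℝ)
    (K : ℕ) (g : ℕ → ℝ) (k : ℕ) (W : GaugeField (F.P K) (k + 1) (SU N)) :
    stepOutT F N T χ ε K g k (mainTermT F N ε K g k + (0 : ℝ) • EkT F N T χ ε K g k) W = zeroInputMergedTermT F N T χ ε K g k W := by
  rw [zero_smul, add_zero, zeroInputMergedTermT_eq_stepOut]

/-- **THE PENCIL'S INCREMENT IS THE RESPONSE TO `t·𝐄_k` MINUS `t·𝐄_k` TRANSPORTED** (§2's shape at `A := A⁰_k`, `E := t·𝐄_k`):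
`R_k(A⁰_k + t𝐄_k)(W) − 𝓝⁰_{k+1}(W) = [𝐓_k(A⁰_k + t𝐄_k) − 𝐓_k(A⁰_k)](W) − t·𝐄_k(Ū^k U_{k+1} W)`. [cite: Balaban1987RG1, (1.6) p.261 (bookkeeping)] -/
theorem stepOutT_main_add_smul_sub (T : Transport F N) (χ : (K : ℕ) → (ℕ → ℝ) → (k : ℕ) → Density (F.P K) k (SU N)) (ε : ℝ)
    (K : ℕ) (g : ℕ → ℝ) (k : ℕ) (t : ℝ) (W : GaugeField (F.P K) (k + 1) (SU N)) :
    stepOutT F N T χ ε K g k (mainTermT F N ε K g k + t • EkT F N T χ ε K g k) W - zeroInputMergedTermT F N T χ ε K g k W =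
      (nextAction (T K k) (χ K g k) (gfOfRecord F N K k) (g k) (mainTermT F N ε K g k + t • EkT F N T χ ε K g k) W -
          nextAction (T K k) (χ K g k) (gfOfRecord F N K k) (g k) (mainTermT F N ε K g k) W) -
        t * EkT F N T χ ε K g k (Averaging.iter (avOfRecord F N K) k (Uk F N K (k + 1) ε W)) := by
  rw [zeroInputMergedTermT_eq_stepOut, stepOutT_add_sub]
  rfl

/-- **THE STEP AT THE UNIT CONFIGURATION**: `R_k(A)(1) = −A(Ū^k U_{k+1}(1))` — the (0.19) normalisation *«log 𝐍_k⁻¹ …, 𝐍_k given by the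
integral above with V = 1»* makes `𝐓_k(A)(1) = 0` for EVERY input (`B12Eq019ActionBody.nextAction_one`); p. 268: *«the normalization constant
N_k^* is equal to the integral above at U_{k+1} = 1»*.  (The [B11] reduction of the right-hand side at the flat datum is a separate row.)
[cite: Balaban1987RG1, (0.19) p.255–256, (2.12) p.268] -/
theorem stepOutT_one (T : Transport F N) (χ : (K : ℕ) → (ℕ → ℝ) → (k : ℕ) → Density (F.P K) k (SU N)) (ε : ℝ) (K : ℕ)
    (g : ℕ → ℝ) (k : ℕ) (A : Density (F.P K) k (SU N)) :
    stepOutT F N T χ ε K g k A 1 = - A (Averaging.iter (avOfRecord F N K) k (Uk F N K (k + 1) ε 1)) := by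
  rw [stepOutT, B12Eq019ActionBody.nextAction_one, zero_sub]

/-! ## §3. (1.19) ∕ (2.16) — gauge invariance of `A⁰_k`, of the step functional `R_k(A)` for a gauge-invariant `A`, of 𝓝⁰, 𝓝, 𝓓 -/

variable {F N}

/-- **`A(U_k(V^v)) = A(U_k(V))` FOR ALL `v`, `V`** (`k ≤ m + K`), UNCONDITIONALLY: on the solvable set both `U_k(V^v)` and the lifted minimiser
`(U_k V)^{v̄}` (`v̄ = blockLift k v`, `Node00.isBackground_gaugeAct_toMS'`) minimise `A` over `V^v`, so their Wilson actions agree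
(`Node00.wilsonAction4_eq_of_isBackground`) and `A` is gauge invariant (`B14Eq16FaddeevPopov.wilsonAction4_gaugeAct'`); off it both sides are
the junk default `U_k = 1` (`Node00.ukExists_gaugeAct_iff'`, `Node00.Uk_of_not`). [cite: Balaban1987RG1, (0.21)–(0.22) p.256; Balaban1985Variational, (181) p.307] -/
theorem wilsonAction4_Uk_gaugeAct {K k : ℕ} (hk : k ≤ (F.P K).m + (F.P K).K) (ε : ℝ) (v : GaugeTransf (F.P K) k (SU N))
    (V : GaugeField (F.P K) k (SU N)) :
    wilsonAction4 (Uk F N K k ε (gaugeAct v V)) = wilsonAction4 (Uk F N K k ε V) := by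
  by_cases h : UkExists F N K k ε V
  · have h' : IsBackground (avOfRecord F N K) (bgReg F N K k ε) k (gaugeAct v V) (gaugeAct (blockLift k v) (Uk F N K k ε V)) := by
      have hb := isBackground_gaugeAct_toMS' (ε := ε) hk (isBackground_Uk h) (blockLift k v)
      rwa [toMS_blockLift_self hk] at hb
    rw [← wilsonAction4_eq_of_isBackground h', B14Eq16FaddeevPopov.wilsonAction4_gaugeAct']
  · have h' : ¬ UkExists F N K k ε (gaugeAct v V) := fun h'' => h ((ukExists_gaugeAct_iff' hk v V).1 h'')
    rw [Uk_of_not h, Uk_of_not h']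

variable (F N)

/-- **THE MAIN TERM `A⁰_k = −(1∕g_k²)A(U_k(·))` IS GAUGE INVARIANT on `T⁽ᵏ⁾`** (`k ≤ m + K`) — p. 263: *«This assumption [(1.19)] is an easily
verifiable statement for all explicitly defined terms in the action (1.3)»*. [cite: Balaban1987RG1, (1.19) p.263, (1.3) p.260] -/
theorem gaugeInvariant_mainTermT (ε : ℝ) {K : ℕ} (g : ℕ → ℝ) {k : ℕ} (hk : k ≤ (F.P K).m + (F.P K).K) :
    GaugeInvariant (mainTermT F N ε K g k) := by
  intro v V
  show -(1 / (g k) ^ 2) * wilsonAction4 (Uk F N K k ε (gaugeAct v V)) = -(1 / (g k) ^ 2) * wilsonAction4 (Uk F N K k ε V)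
  rw [wilsonAction4_Uk_gaugeAct hk]

variable {F N}

/-- **[15] (181) FOR THE BARE CHOICE, AT ORBIT LEVEL**: if (0.21) is solvable at `V` and the minimal orbit over `V^v` is unique, the lifted
minimiser `(U_k V)^{v̄}` and the choice `U_k(V^v)` lie in ONE orbit of the residual group of level `k` (sibling of `Node00.UkSel_gaugeAct_blockLift`,
which states the same for the rooted-gauge offer as an equality). [cite: Balaban1985Variational, (181) p.307 and Thm 1 p.279; Balaban1987RG1, (0.21) p.256] -/
theorem orbitRel_Uk_gaugeAct_blockLift {K k : ℕ} (hk : k ≤ (F.P K).m + (F.P K).K) {ε : ℝ} (v : GaugeTransf (F.P K) k (SU N))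
    {V : GaugeField (F.P K) k (SU N)} (h : UkExists F N K k ε V) (hu : UniqueUkOrbit F N K k ε (gaugeAct v V)) :
    OrbitRel k (gaugeAct (blockLift k v) (Uk F N K k ε V)) (Uk F N K k ε (gaugeAct v V)) := by
  have h' : IsBackground (avOfRecord F N K) (bgReg F N K k ε) k (gaugeAct v V) (gaugeAct (blockLift k v) (Uk F N K k ε V)) := by
    have hb := isBackground_gaugeAct_toMS' (ε := ε) hk (isBackground_Uk h) (blockLift k v)
    rwa [toMS_blockLift_self hk] at hb
  exact hu _ _ h' (isBackground_Uk ((ukExists_gaugeAct_iff' hk v V).2 h))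

/-- **A GAUGE-INVARIANT LEVEL-k FUNCTIONAL READS THE SAME VALUE AT `Ū^k U_{k+1}(W^v)` AND AT `Ū^k U_{k+1}(W)`** (`k + 1 ≤ m + K`, `UkExists (k+1) W`,
`UniqueUkOrbit (k+1) (W^v)`): by `orbitRel_Uk_gaugeAct_blockLift`, `U_{k+1}(W^v) = (U_{k+1}W)^{v̄}` up to a residual transformation `u`, and the
k-fold average intertwines every fine gauge transformation with its restriction (`B16Sect1Backgrounds.iter_gaugeAct`) — CRIT-1's «residual-invariant
bound action» condition met by gauge invariance on `T⁽ᵏ⁾`. [cite: Balaban1987RG1, (0.21) p.256, (2.16) p.269; Balaban1985Variational, (181) p.307] -/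
theorem apply_iter_Uk_gaugeAct {K k : ℕ} (hk : k + 1 ≤ (F.P K).m + (F.P K).K) {ε : ℝ} {A : Density (F.P K) k (SU N)}
    (hA : GaugeInvariant A) (v : GaugeTransf (F.P K) (k + 1) (SU N)) {W : GaugeField (F.P K) (k + 1) (SU N)}
    (hW : UkExists F N K (k + 1) ε W) (hu : UniqueUkOrbit F N K (k + 1) ε (gaugeAct v W)) :
    A (Averaging.iter (avOfRecord F N K) k (Uk F N K (k + 1) ε (gaugeAct v W))) =
      A (Averaging.iter (avOfRecord F N K) k (Uk F N K (k + 1) ε W)) := by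
  obtain ⟨u, -, hEq⟩ := orbitRel_Uk_gaugeAct_blockLift hk v hW hu
  have hk' : k ≤ (F.P K).m + (F.P K).K := Nat.le_of_succ_le hk
  rw [hEq, iter_gaugeAct (avOfRecord F N K) u _ k hk', hA, iter_gaugeAct (avOfRecord F N K) (blockLift (k + 1) v) _ k hk', hA]

variable (F N)

/-- **(1.19) ∕ (2.16) FOR THE STEP FUNCTIONAL**: `R_k(A)(W^v) = R_k(A)(W)` for every coarse gauge transformation `v` of `T⁽ᵏ⁺¹⁾`, from: the
mapping property of `T K k` (*«If ρ is a gauge invariant function, then Tρ is gauge invariant also»*, p. 254), `LiftInvariant (χ K g k)` (p. 265: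
the δ-∕χ-functions in (2.1) are invariant), `GaugeInvariant A` (the bound action; gives both the lift-invariance the first summand needs and the
residual-invariance the second needs), `k + 1 ≤ m + K`, and the [B11] clauses `UkExists (k+1) W`, `UniqueUkOrbit (k+1) (W^v)`.  The first summand is
`B12EffectiveActionInvarianceT.gaugeInvariant_nextAction` with `gfOfRecord_liftInvariant`; the second is `apply_iter_Uk_gaugeAct`.
[cite: Balaban1987RG1, (1.19) p.263, (2.16) p.269, (0.13) p.254] -/
theorem stepOutT_gaugeAct (T : Transport F N) (χ : (K : ℕ) → (ℕ → ℝ) → (k : ℕ) → Density (F.P K) k (SU N)) (ε : ℝ) {K : ℕ}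
    (g : ℕ → ℝ) {k : ℕ} (hk : k + 1 ≤ (F.P K).m + (F.P K).K)
    (hT : ∀ ρ : Density (F.P K) k (SU N), LiftInvariant ρ → GaugeInvariant (T K k ρ)) (hχ : LiftInvariant (χ K g k))
    {A : Density (F.P K) k (SU N)} (hA : GaugeInvariant A) (v : GaugeTransf (F.P K) (k + 1) (SU N))
    {W : GaugeField (F.P K) (k + 1) (SU N)} (hW : UkExists F N K (k + 1) ε W) (hu : UniqueUkOrbit F N K (k + 1) ε (gaugeAct v W)) :
    stepOutT F N T χ ε K g k A (gaugeAct v W) = stepOutT F N T χ ε K g k A W := by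
  rw [stepOutT, stepOutT, gaugeInvariant_nextAction hT hχ (gfOfRecord_liftInvariant F N K hk) (liftInvariant_of_gaugeInvariant hA) (g k) v W,
    apply_iter_Uk_gaugeAct hk hA v hW hu]

/-- **THE (1.19) ROW OF (Z) AT THE FUNCTIONAL LEVEL**: `𝓝⁰_{k+1}(W^v) = 𝓝⁰_{k+1}(W)` (`stepOutT_gaugeAct` at `A := A⁰_k`, whose gauge invariance is
`gaugeInvariant_mainTermT`). [cite: Balaban1987RG1, (1.19) p.263, (2.16) p.269] -/
theorem zeroInputMergedTermT_gaugeAct (T : Transport F N) (χ : (K : ℕ) → (ℕ → ℝ) → (k : ℕ) → Density (F.P K) k (SU N)) (ε : ℝ)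
    {K : ℕ} (g : ℕ → ℝ) {k : ℕ} (hk : k + 1 ≤ (F.P K).m + (F.P K).K)
    (hT : ∀ ρ : Density (F.P K) k (SU N), LiftInvariant ρ → GaugeInvariant (T K k ρ)) (hχ : LiftInvariant (χ K g k))
    (v : GaugeTransf (F.P K) (k + 1) (SU N)) {W : GaugeField (F.P K) (k + 1) (SU N)} (hW : UkExists F N K (k + 1) ε W)
    (hu : UniqueUkOrbit F N K (k + 1) ε (gaugeAct v W)) :
    zeroInputMergedTermT F N T χ ε K g k (gaugeAct v W) = zeroInputMergedTermT F N T χ ε K g k W := by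
  rw [zeroInputMergedTermT_eq_stepOut, zeroInputMergedTermT_eq_stepOut]
  exact stepOutT_gaugeAct F N T χ ε g hk hT hχ (gaugeInvariant_mainTermT F N ε g (Nat.le_of_succ_le hk)) v hW hu

/-- **THE MERGED TERM IS GAUGE INVARIANT** (`𝓝_{k+1}(W^v) = 𝓝_{k+1}(W)`): `stepOutT_gaugeAct` at `A := A_k`, whose gauge invariance is
`B12EffectiveActionInvarianceT.gaugeInvariant_effActionHT` — mapping property of `T K j` and `LiftInvariant (χ K g j)` at every step `j + 1 ≤ m + K`
(DISPLAYED hypotheses: at the bare record `χ := chiβOfRecord₁₃ θ` they are NOT available as vetted — CRIT-1 Q-3 — and this row is not instantiated there).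
[cite: Balaban1987RG1, (2.16) p.269, p.263] -/
theorem mergedTermT_gaugeAct (T : Transport F N) (χ : (K : ℕ) → (ℕ → ℝ) → (k : ℕ) → Density (F.P K) k (SU N)) (ε : ℝ) {K : ℕ}
    (g : ℕ → ℝ) {k : ℕ} (hk : k + 1 ≤ (F.P K).m + (F.P K).K)
    (hT : ∀ K j, j + 1 ≤ (F.P K).m + (F.P K).K → ∀ ρ : Density (F.P K) j (SU N), LiftInvariant ρ → GaugeInvariant (T K j ρ))
    (hχ : ∀ j, j + 1 ≤ (F.P K).m + (F.P K).K → LiftInvariant (χ K g j))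
    (v : GaugeTransf (F.P K) (k + 1) (SU N)) {W : GaugeField (F.P K) (k + 1) (SU N)} (hW : UkExists F N K (k + 1) ε W)
    (hu : UniqueUkOrbit F N K (k + 1) ε (gaugeAct v W)) :
    mergedTermT F N T χ ε K g k (gaugeAct v W) = mergedTermT F N T χ ε K g k W := by
  rw [mergedTermT_eq_stepOut, mergedTermT_eq_stepOut]
  exact stepOutT_gaugeAct F N T χ ε g hk (hT K k hk) (hχ k hk)
    (gaugeInvariant_effActionHT F N T hT χ K g hχ k (Nat.le_of_succ_le hk)) v hW hu

/-- **THE (1.19) ROW OF (L) AT THE FUNCTIONAL LEVEL**: the difference functional `𝓓_{k+1} := 𝓝_{k+1} − 𝓝⁰_{k+1}` is gauge invariant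
(`mergedTermT_gaugeAct` − `zeroInputMergedTermT_gaugeAct`; same displayed hypotheses). [cite: Balaban1987RG1, (1.19) p.263, (2.16) p.269] -/
theorem dChannel_gaugeAct (T : Transport F N) (χ : (K : ℕ) → (ℕ → ℝ) → (k : ℕ) → Density (F.P K) k (SU N)) (ε : ℝ) {K : ℕ}
    (g : ℕ → ℝ) {k : ℕ} (hk : k + 1 ≤ (F.P K).m + (F.P K).K)
    (hT : ∀ K j, j + 1 ≤ (F.P K).m + (F.P K).K → ∀ ρ : Density (F.P K) j (SU N), LiftInvariant ρ → GaugeInvariant (T K j ρ))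
    (hχ : ∀ j, j + 1 ≤ (F.P K).m + (F.P K).K → LiftInvariant (χ K g j))
    (v : GaugeTransf (F.P K) (k + 1) (SU N)) {W : GaugeField (F.P K) (k + 1) (SU N)} (hW : UkExists F N K (k + 1) ε W)
    (hu : UniqueUkOrbit F N K (k + 1) ε (gaugeAct v W)) :
    mergedTermT F N T χ ε K g k (gaugeAct v W) - zeroInputMergedTermT F N T χ ε K g k (gaugeAct v W) =
      mergedTermT F N T χ ε K g k W - zeroInputMergedTermT F N T χ ε K g k W := by
  rw [mergedTermT_gaugeAct F N T χ ε g hk hT hχ v hW hu, zeroInputMergedTermT_gaugeAct F N T χ ε g hk (hT K k hk) (hχ k hk) v hW hu]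

end Summit.QuantumFields.YangMills.Theorems.PortZD

end
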